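import Summits.AtomisticToContinuum.Crystallization.Theorems.FrustratedLawDichotomyStrainedPatchHomCurvLeaf

/-!
# The SLOPE LEAF of lever (C): a kernel Boolean for the gradient bound `G` of `hcpShifted_floor_W45`

decomp-a2c hand-1 g26 (crux `AperiodicFrustratedLawGap`, stmt-AtomisticToContinuum-27623; `(H) HomFloor (1/625)`, hcp half).  The `hG` input of
`…HomConvexSegmentW45.hcpShifted_floor_W45` is `|Σ_b segG W₄₅′ p_b Δ 0| ≤ G‖Δ‖`, reduced by `…HomConvexCurvature.slopeSum_abs_le_of_enclosure` to
`ℓ¹` enclosures of the gradient vector `g = Σ_b β_b·p_b`, `β_b = W₄₅′(‖p_b‖)/‖p_b‖`.  Here: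

* §1 `mem_coeffFI_beta` — the `β`-component of `…HomCurvDispatch.coeffFI` encloses `β(ρ)` for EVERY `ρ > 0`, junction radii INCLUDED (`β` is
  continuous; the closed-regime formulas of `…HomTermCalculus` overlap at the junctions), so no junction hypothesis is needed at `s = 0`;
* §2 `slopeCheck c w L Gs : Bool` (per label `C_b := vecB`, `B_b := (coeffFI Q_b).2`, gradient coordinates `accFI L (B_b·C_b i)`, test
  `Σ_i absHi ≤ Gs`) and ★★★ `slope_bound_of_slopeCheck`: for `U` in the entry box (`‖U − 1‖ ≤ 1/4`) and shuffles `ξ₀` (box, norm `≤ 1/4`), `ξ`: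
  `|Σ_{b ∈ L} segG (deriv W₄₅) (latPt U hexFrame b + U(hcpShift + ξ₀)) (U(ξ − ξ₀)) 0| ≤ (Gs/SC)·‖U(ξ − ξ₀)‖`.

One kernel definition + soundness; 0 sorry; standard axioms; no instances / notation / `#eval`.  `--supports stmt-AtomisticToContinuum-27623`.
-/

noncomputable section

namespace Summit.AtomisticToContinuum.Crystallization.Theorems.FrustratedLawDichotomyStrainedPatchHomCurvLeaf

open scoped BigOperators RealInnerProductSpace
open Literature.Analysis.ValidatedNumerics.Numerics
open Summit.AtomisticToContinuum.Crystallization.Theorems.ChargedEnergyGapNegative (E3)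
open Summit.AtomisticToContinuum.Crystallization.Theorems.FrustratedLawDichotomySchurCut (effPot w₄₅ ω₄)
open Summit.AtomisticToContinuum.Crystallization.Theorems.FrustratedLawDichotomyStrainedPatchHomSplit (latPt hexFrame hcpShift)
open Summit.AtomisticToContinuum.Crystallization.Theorems.FrustratedLawDichotomyStrainedPatchHomEntryGram (entryFI mem_entryFI)
open Summit.AtomisticToContinuum.Crystallization.Theorems.FrustratedLawDichotomyStrainedPatchHomEntryGramHcp (dot3 shufFI mem_dot3 mem_shufFI)
open Summit.AtomisticToContinuum.Crystallization.Theorems.FrustratedLawDichotomyStrainedPatchHomForceKit (phiFI mem_phiFI vecB mem_vecB)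
open Summit.AtomisticToContinuum.Crystallization.Theorems.FrustratedLawDichotomyStrainedPatchHomTermCalculus
  (deriv_effPot45_bump deriv_effPot45_lj deriv_effPot45_window deriv_effPot45_far)
open Summit.AtomisticToContinuum.Crystallization.Theorems.FrustratedLawDichotomyStrainedPatchHomCurvCoeff
open Summit.AtomisticToContinuum.Crystallization.Theorems.FrustratedLawDichotomyStrainedPatchHomCurvKit (accFI mem_accFI)
open Summit.AtomisticToContinuum.Crystallization.Theorems.FrustratedLawDichotomyStrainedPatchHomConvexCurvature (slopeSum_abs_le_of_enclosure)
open Summit.AtomisticToContinuum.Crystallization.Theorems.FrustratedLawDichotomyStrainedPatchTaylorChord (segG)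
open Summit.AtomisticToContinuum.Crystallization.Theorems.FrustratedLawDichotomyStrainedPatchHomLatticeBoxHcp (norm_shifted_gt)

/-! ## §1. `β` is enclosed at every radius, junctions included -/

/-- `β = W′/ρ` in the `q`-forms of `…HomCurvRegime` on the CLOSED regimes (the formulas agree at the junctions). [arithmetic] -/
theorem beta_bump_closed {ρ : ℝ} (h0 : 0 < ρ) (h1 : ρ ≤ 8 / 5) :
    deriv (effPot w₄₅ ω₄ (3 / 400)) ρ / ρ = ((ρ ^ 2)⁻¹) ^ 4 - ((ρ ^ 2)⁻¹) ^ 7 -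
      3 / 160 * (5 / 4 * (-(11 / 3) + 33 / 4 * (5 * ρ / 4) ^ 2 - 385 / 64 * (5 * ρ / 4) ^ 3 + 231 / 256 * (5 * ρ / 4) ^ 5 -
        99 / 1024 * (5 * ρ / 4) ^ 7 + 55 / 12288 * (5 * ρ / 4) ^ 9)) := by
  have hρ : ρ ≠ 0 := h0.ne'
  rw [deriv_effPot45_bump h0 h1]; field_simp; ring

/-- [arithmetic] -/
theorem beta_lj_closed {ρ : ℝ} (h1 : 8 / 5 ≤ ρ) (h2 : ρ ≤ 3) :
    deriv (effPot w₄₅ ω₄ (3 / 400)) ρ / ρ = ((ρ ^ 2)⁻¹) ^ 4 - ((ρ ^ 2)⁻¹) ^ 7 := by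
  have hρ : ρ ≠ 0 := by linarith
  rw [deriv_effPot45_lj h1 h2]; field_simp; ring

/-- [arithmetic] -/
theorem beta_window_closed {ρ : ℝ} (h1 : 3 ≤ ρ) (h2 : ρ ≤ 9 / 2) :
    deriv (effPot w₄₅ ω₄ (3 / 400)) ρ / ρ =
      (((ρ ^ 2)⁻¹) ^ 4 - ((ρ ^ 2)⁻¹) ^ 7) * ((16 * ρ ^ 3 - 180 * ρ ^ 2 + 648 * ρ - 729) / 27) +
        (1 / 12 * ((ρ ^ 2)⁻¹) ^ 6 - 1 / 6 * ((ρ ^ 2)⁻¹) ^ 3) * ((16 * ρ ^ 2 - 120 * ρ + 216) / 9) * ρ * (ρ ^ 2)⁻¹ := by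
  have hρ : ρ ≠ 0 := by linarith
  rw [deriv_effPot45_window h1 h2]
  simp only [Literature.MathematicalPhysics.StatisticalMechanics.lennardJones]
  field_simp; ring

/-- Flag lemmas on the closed regimes (`64·2⁴⁸/25` and `81·2⁴⁸/4`… the end-point roundings are what make the closed ends work; at `q = 9` one of
the two neighbouring flags is raised unless the enclosure is the point `9`, where `coeffFI` fails anyway). [folklore] -/
theorem canB_of_le {ρ : ℝ} {Q : FI} (hq : FI.mem (ρ ^ 2) Q) (h0 : 0 < ρ) (h : ρ ≤ 8 / 5) : canB Q = true := by
  have hS : (0 : ℝ) < SC := by norm_num [SC]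
  simp only [canB, decide_eq_true_eq]
  have hle : ρ ^ 2 ≤ 64 / 25 := by nlinarith
  have h1 : (Q.lo : ℝ) ≤ 64 / 25 * SC := hq.1.trans (by nlinarith)
  -- `(64/25)·SC` is not an integer, and `⌈64·SC/25⌉ = (ofFrac 64 25).hi`
  have hhi : (FI.ofFrac 64 25).hi = 720575940379280 := by decide +kernel
  rw [hhi]
  have : (Q.lo : ℝ) < 720575940379280 := by rw [SC] at h1; push_cast at h1; linarith
  exact_mod_cast this

/-- ★ **`β` membership WITHOUT a junction hypothesis**: for every `ρ > 0` with `ρ² ∈ Q` and `coeffFI Q = some (A, B)`, `W₄₅′(ρ)/ρ ∈ B`. [folklore] -/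
theorem mem_coeffFI_beta {ρ : ℝ} (h0 : 0 < ρ) {Q : FI} (hq : FI.mem (ρ ^ 2) Q) {AB : FI × FI} (h : coeffFI Q = some AB) :
    FI.mem (deriv (effPot w₄₅ ω₄ (3 / 400)) ρ / ρ) AB.2 := by
  by_cases hJ : ρ ∉ Summit.AtomisticToContinuum.Crystallization.Theorems.FrustratedLawDichotomyStrainedPatchTaylorLeaves.junctions
  · exact (mem_coeffFI h0 hJ hq h).2
  have hJ' : ρ ∈ Summit.AtomisticToContinuum.Crystallization.Theorems.FrustratedLawDichotomyStrainedPatchTaylorLeaves.junctions := not_not.mp hJ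
  have hcases : ρ = 8 / 5 ∨ ρ = 3 ∨ ρ = 9 / 2 := by
    simpa [Summit.AtomisticToContinuum.Crystallization.Theorems.FrustratedLawDichotomyStrainedPatchTaylorLeaves.junctions] using hJ'
  -- unpack `coeffFI` as in `mem_coeffFI`
  unfold coeffFI at h
  cases haB : alphaBumpFI Q with
  | none => rw [haB] at h; exact absurd h (by simp)
  | some aB =>
  cases hbB : betaBumpFI Q with
  | none => rw [haB, hbB] at h; exact absurd h (by simp)
  | some bB =>
  cases haL : alphaLJFI Q with
  | none => rw [haB, hbB, haL] at h; exact absurd h (by simp)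
  | some aL =>
  cases hbL : phiFI Q with
  | none => rw [haB, hbB, haL, hbL] at h; exact absurd h (by simp)
  | some bL =>
  cases haW : alphaWinFI Q with
  | none => rw [haB, hbB, haL, hbL, haW] at h; exact absurd h (by simp)
  | some aW =>
  cases hbW : betaWinFI Q with
  | none => rw [haB, hbB, haL, hbL, haW, hbW] at h; exact absurd h (by simp)
  | some bW =>
  rw [haB, hbB, haL, hbL, haW, hbW] at h
  simp only at h
  cases hSA : sel Q aB aL aW with
  | none => rw [hSA] at h; exact absurd h (by simp)
  | some A =>
  cases hSB : sel Q bB bL bW with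
  | none => rw [hSA, hSB] at h; exact absurd h (by simp)
  | some B =>
  rw [hSA, hSB] at h
  simp only [Option.some.injEq] at h
  subst h
  rcases hcases with rfl | rfl | rfl
  · -- ρ = 8/5: bump flag is raised, bump formula valid on the closed regime
    have hc := canB_of_le hq h0 le_rfl
    refine mem_sel_B hc ?_ hSB
    rw [beta_bump_closed h0 le_rfl]; exact mem_betaBumpFI h0.le hq hbB
  · -- ρ = 3: either the LJ flag or the window flag is raised (else `sel` would have been `none` only if also far/bump fail — handle by cases)
    by_cases hL : canL Q = true
    · refine mem_sel_L hL ?_ hSB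
      rw [beta_lj_closed (by norm_num) le_rfl]; exact mem_phiFI hq hbL
    · by_cases hW : canW Q = true
      · refine mem_sel_W hW ?_ hSB
        rw [beta_window_closed le_rfl (by norm_num)]; exact mem_betaWinFI h0.le hq hbW
      · -- both neighbouring flags down at q = 9 forces Q to be the point 9: then canB and canF are down too and `sel = none`
        exfalso
        have hS : (0 : ℝ) < SC := by norm_num [SC]
        simp only [canL, canW, decide_eq_true_eq, not_and_or, not_lt] at hL hW
        have hq1 := hq.1; have hq2 := hq.2
        have h9lo : (FI.ofInt 9).lo = 9 * SC := rfl
        have h9hi : (FI.ofInt 9).hi = 9 * SC := rfl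
        have ht1 : (FI.ofFrac 64 25).lo = 720575940379279 := by decide +kernel
        have ht3 : (FI.ofFrac 81 4).hi = 5699868278390784 := by decide +kernel
        norm_num at hq1 hq2
        rcases hL with hL | hL
        · rw [ht1] at hL
          have : (Q.hi : ℝ) ≤ 720575940379279 := by exact_mod_cast hL
          rw [SC] at hq2; push_cast at hq2; linarith
        rcases hW with hW | hW
        · rw [h9lo] at hW
          rw [h9hi] at hL
          -- Q.hi ≤ 9·SC ≤ Q.lo: the point interval; then `canB` false and `canF` false, so `sel … = none`, contradiction with hSB
          -- here `hL : 9·SC ≤ Q.lo` and `hW : Q.hi ≤ 9·SC`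
          have hB' : canB Q = false := by
            simp only [canB, decide_eq_false_iff_not, not_lt]
            have hhi : (FI.ofFrac 64 25).hi = 720575940379280 := by decide +kernel
            rw [hhi]
            have h' : ((9 * (SC : ℤ) : ℤ) : ℝ) ≤ (Q.lo : ℝ) := by exact_mod_cast hL
            rw [SC] at h'; push_cast at h'
            have : (720575940379280 : ℝ) ≤ Q.lo := by linarith
            exact_mod_cast this
          have hF' : canF Q = false := by
            simp only [canF, decide_eq_false_iff_not, not_lt]
            have hlo3 : (FI.ofFrac 81 4).lo = 5699868278390784 := by decide +kernel
            rw [hlo3]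
            have h' : ((Q.hi : ℤ) : ℝ) ≤ ((9 * (SC : ℤ) : ℤ) : ℝ) := by exact_mod_cast hW
            rw [SC] at h'; push_cast at h'
            have : (Q.hi : ℝ) ≤ 5699868278390784 := by linarith
            exact_mod_cast this
          have hLf : canL Q = false := by
            simp only [canL, decide_eq_false_iff_not, not_and_or, not_lt]; exact Or.inr (by rw [h9hi]; exact hL)
          have hWf : canW Q = false := by
            simp only [canW, decide_eq_false_iff_not, not_and_or, not_lt]; exact Or.inl (by rw [h9lo]; exact hW)
          have : sel Q bB bL bW = none := by simp [sel, pick, hB', hF', hLf, hWf]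
          rw [this] at hSB; exact absurd hSB (by simp)
        · rw [ht3] at hW
          have : (5699868278390784 : ℝ) ≤ Q.lo := by exact_mod_cast hW
          rw [SC] at hq1; push_cast at hq1; linarith
  · -- ρ = 9/2: window flag or far flag
    by_cases hW : canW Q = true
    · refine mem_sel_W hW ?_ hSB
      rw [beta_window_closed (by norm_num) le_rfl]; exact mem_betaWinFI h0.le hq hbW
    · by_cases hF : canF Q = true
      · have hz : deriv (effPot w₄₅ ω₄ (3 / 400)) (9 / 2) / (9 / 2) = 0 := by rw [deriv_effPot45_far le_rfl, zero_div]
        rw [hz]; exact mem_sel_F hF hSB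
      · exfalso
        simp only [canW, canF, decide_eq_true_eq, not_and_or, not_lt] at hW hF
        have hq1 := hq.1; have hq2 := hq.2
        have ht3lo : (FI.ofFrac 81 4).lo = 5699868278390784 := by decide +kernel
        have ht3hi : (FI.ofFrac 81 4).hi = 5699868278390784 := by decide +kernel
        have h9lo : (FI.ofInt 9).lo = 9 * SC := rfl
        norm_num at hq1 hq2
        rw [ht3lo] at hF
        have hF' : (Q.hi : ℝ) ≤ 5699868278390784 := by exact_mod_cast hF
        rcases hW with hW | hW
        · rw [h9lo] at hW
          have h' : ((Q.hi : ℤ) : ℝ) ≤ ((9 * (SC : ℤ) : ℤ) : ℝ) := by exact_mod_cast hW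
          rw [SC] at h' hq2; push_cast at h' hq2; linarith
        · rw [ht3hi] at hW
          have hW' : (5699868278390784 : ℝ) ≤ Q.lo := by exact_mod_cast hW
          -- point interval at 81/4: then canB, canL false too ⇒ sel = none
          have hB' : canB Q = false := by
            simp only [canB, decide_eq_false_iff_not, not_lt]
            have hhi : (FI.ofFrac 64 25).hi = 720575940379280 := by decide +kernel
            rw [hhi]
            have : (720575940379280 : ℝ) ≤ Q.lo := by linarith
            exact_mod_cast this
          have hLf : canL Q = false := by
            simp only [canL, decide_eq_false_iff_not, not_and_or, not_lt]
            refine Or.inr ?_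
            show (FI.ofInt 9).hi ≤ Q.lo
            have : ((FI.ofInt 9).hi : ℝ) ≤ Q.lo := by
              rw [show (FI.ofInt 9).hi = 9 * SC from rfl]; push_cast; rw [SC]; push_cast; linarith
            exact_mod_cast this
          have hWf : canW Q = false := by
            simp only [canW, decide_eq_false_iff_not, not_and_or, not_lt]
            refine Or.inr ?_
            rw [ht3hi]; exact_mod_cast (show (5699868278390784 : ℝ) ≤ Q.lo from hW')
          have hFf : canF Q = false := by
            simp only [canF, decide_eq_false_iff_not, not_lt]; rw [ht3lo]; exact hF
          have : sel Q bB bL bW = none := by simp [sel, pick, hB', hFf, hLf, hWf]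
          rw [this] at hSB; exact absurd hSB (by simp)

/-! ## §2. The slope Boolean and its soundness -/

/-- ★ **SLOPE CHECK** over the box `(c, w)`, label list `L`, bound `Gs/SC`: all `coeffFI` succeed and the `ℓ¹` size of the gradient-vector
enclosure `g_i = Σ_b B_b·C_b i` is `≤ Gs`. -/
def slopeCheck (c w : (Fin 3 × Fin 3) ⊕ Fin 3 → ℤ) (L : List (Fin 3 → ℤ)) (Gs : ℤ) : Bool :=
  let E := entryFI (fun ab => c (Sum.inl ab)) (fun ab => w (Sum.inl ab))
  let X := shufFI c w
  let C : (Fin 3 → ℤ) → Fin 3 → FI := fun b => vecB E X b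
  let K : (Fin 3 → ℤ) → Option (FI × FI) := fun b => coeffFI (dot3 (C b) (C b))
  (L.all fun b => (K b).isSome) &&
    decide ((∑ i : Fin 3, (accFI L fun b => (((K b).getD (FI.ofInt 0, FI.ofInt 0)).2).mul (C b i)).absHi) ≤ Gs)

/-- ★★★ **SOUNDNESS OF THE SLOPE LEAF.**  If `slopeCheck c w L Gs = true` (`L` duplicate-free) then for every `U` with entries in the box and
`‖U − 1‖ ≤ 1/4`, every shuffle `ξ₀` in the box with `‖ξ₀‖ ≤ 1/4` and every `ξ`:
`|Σ_{b ∈ L.toFinset} segG (deriv W₄₅) (latPt U hexFrame b + U(hcpShift + ξ₀)) (U(ξ − ξ₀)) 0| ≤ (Gs/SC)·‖U(ξ − ξ₀)‖` — the `hG` input of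
`…HomConvexSegmentW45.hcpShifted_floor_W45`. [folklore chaining] -/
theorem slope_bound_of_slopeCheck {c w : (Fin 3 × Fin 3) ⊕ Fin 3 → ℤ} {L : List (Fin 3 → ℤ)} (hL : L.Nodup) {Gs : ℤ}
    (h : slopeCheck c w L Gs = true) (U : E3 →L[ℝ] E3) (hU : ‖U - 1‖ ≤ 1 / 4)
    (hbox : ∀ ab : Fin 3 × Fin 3, |(U (EuclideanSpace.single ab.2 (1 : ℝ))) ab.1 - (c (Sum.inl ab) : ℝ) / SC| ≤ (w (Sum.inl ab) : ℝ) / SC)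
    (ξ₀ : E3) (hξ₀ : ∀ i : Fin 3, |ξ₀ i - (c (Sum.inr i) : ℝ) / SC| ≤ (w (Sum.inr i) : ℝ) / SC) (hn₀ : ‖ξ₀‖ ≤ 1 / 4) (ξ : E3) :
    |∑ b ∈ L.toFinset, segG (deriv (effPot w₄₅ ω₄ (3 / 400))) (latPt U hexFrame b + U (hcpShift + ξ₀)) (U (ξ - ξ₀)) 0| ≤
      (Gs : ℝ) / SC * ‖U (ξ - ξ₀)‖ := by
  classical
  have hS : (0 : ℝ) < SC := by norm_num [SC]
  unfold slopeCheck at h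
  simp only [Bool.and_eq_true, List.all_eq_true, decide_eq_true_eq] at h
  obtain ⟨hall, hsum⟩ := h
  set E := entryFI (fun ab => c (Sum.inl ab)) (fun ab => w (Sum.inl ab)) with hE
  set X := shufFI c w with hX
  set C : (Fin 3 → ℤ) → Fin 3 → FI := fun b => vecB E X b with hC
  set K : (Fin 3 → ℤ) → Option (FI × FI) := fun b => coeffFI (dot3 (C b) (C b)) with hK
  set g : Fin 3 → FI := fun i => accFI L fun b => (((K b).getD (FI.ofInt 0, FI.ofInt 0)).2).mul (C b i) with hg
  -- per-label memberships at the base point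
  have hCmem : ∀ b : Fin 3 → ℤ, ∀ a : Fin 3, FI.mem ((latPt U hexFrame b + U (hcpShift + ξ₀)) a) (C b a) :=
    fun b a => mem_vecB U ξ₀ (fun ab => mem_entryFI (hbox ab)) (fun i => mem_shufFI (hξ₀ i)) b a
  have hQmem : ∀ b : Fin 3 → ℤ, FI.mem (‖latPt U hexFrame b + U (hcpShift + ξ₀)‖ ^ 2) (dot3 (C b) (C b)) := by
    intro b; rw [← real_inner_self_eq_norm_sq]; exact mem_dot3 (hCmem b) (hCmem b)
  have hρpos : ∀ b : Fin 3 → ℤ, 0 < ‖latPt U hexFrame b + U (hcpShift + ξ₀)‖ := fun b =>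
    lt_trans (by norm_num) (norm_shifted_gt hU hn₀ b)
  have hB : ∀ b ∈ L, FI.mem (deriv (effPot w₄₅ ω₄ (3 / 400)) ‖latPt U hexFrame b + U (hcpShift + ξ₀)‖ / ‖latPt U hexFrame b + U (hcpShift + ξ₀)‖)
      ((K b).getD (FI.ofInt 0, FI.ofInt 0)).2 := by
    have hKsome : ∀ b ∈ L, ∃ AB, K b = some AB := fun b hb => Option.isSome_iff_exists.1 (hall b hb)
    intro b hb
    obtain ⟨AB, hAB⟩ := hKsome b hb
    have := mem_coeffFI_beta (hρpos b) (hQmem b) hAB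
    rw [hAB]; simpa using this
  -- the gradient coordinates are enclosed by `g`
  have hgmem : ∀ i : Fin 3, FI.mem (∑ b ∈ L.toFinset, deriv (effPot w₄₅ ω₄ (3 / 400)) ‖latPt U hexFrame b + U (hcpShift + ξ₀)‖ /
      ‖latPt U hexFrame b + U (hcpShift + ξ₀)‖ * (latPt U hexFrame b + U (hcpShift + ξ₀)) i) (g i) :=
    fun i => mem_accFI L hL fun b hb => FI.mem_mul (hB b hb) (hCmem b i)
  -- conclude with the ℓ¹ slope lemma
  refine slopeSum_abs_le_of_enclosure L.toFinset (deriv (effPot w₄₅ ω₄ (3 / 400))) (fun b => latPt U hexFrame b + U (hcpShift + ξ₀))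
    (fun i => ((g i).lo : ℝ) / SC) (fun i => ((g i).hi : ℝ) / SC) (fun i => FI.lo_div_le (hgmem i)) (fun i => FI.le_hi_div (hgmem i)) ?_ (U (ξ - ξ₀))
  -- `Σ_i max |lo| |hi| = (Σ_i absHi)/SC ≤ Gs/SC`
  have hterm : ∀ i : Fin 3, max |((g i).lo : ℝ) / SC| |((g i).hi : ℝ) / SC| = ((g i).absHi : ℝ) / SC := by
    intro i
    rw [FI.absHi, Int.cast_max, Int.cast_abs, Int.cast_abs, abs_div, abs_div, abs_of_pos hS, max_div_div_right hS.le]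
  simp only [hterm, ← Finset.sum_div]
  have hcast : ((∑ i : Fin 3, (g i).absHi : ℤ) : ℝ) ≤ (Gs : ℝ) := by exact_mod_cast hsum
  push_cast at hcast
  exact div_le_div_of_nonneg_right hcast hS.le

end Summit.AtomisticToContinuum.Crystallization.Theorems.FrustratedLawDichotomyStrainedPatchHomCurvLeaf

end
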